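/-
Copyright (c) 2026. All rights reserved.
Released under Apache 2.0 license as described in the file LICENSE.
Authors: abc-iut cell, prover seat abc-iut-w5-d038 (gen 8; row «ARC-MTC-F3» (L4-lead m134), part F3b at the vertex
`mult`: the archimedean `η⊢_{v,ν}` of [AbsTopIII] Cor 5.10 (iv)(c) for `ν = mult` (`k^×`), over abc-iut-L4-t8's genuine
`TB⊞`-leg (Def 5.6 (iv)) and abc-iut-w6-d025's `k×(G)` (Prop 5.8 (iv)(v)), by the kernel classification of `TB⊞`).
-/
import Literature.AnabelianGeometry.AbsoluteAnabelian.ArchimedeanHolGroupPairsEta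
import Literature.AnabelianGeometry.AbsoluteAnabelian.TBPlusIsoOfKernel
import HarnessLib

/-!
# The archimedean `η⊢_{v,ν}` at the vertex `mult`: `(k^×)^{TB⊞} ⥲ k×(G_𝕏)`, naturally in `(𝕏 ↶ k)` ([AbsTopIII] Cor 5.10 (iv)(c))

S. Mochizuki, *Topics in absolute anabelian geometry III*, Cor 5.10 (iv)(c) p. 148 l. 10–37, VERBATIM (v2, referee lane
L14-n6; arrow labels `λ⊞_{v,ν}`, `φ^{An⊢⊞}_{v,ν}` and the clause on `D•_{≤5}`/`D⊢` dropped at «…»): «there is a natural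
isomorphism `η⊢_{v,ν}` from the composite functor determined by the path `γ¹_{v,ν}` [of length 6] `𝒳 → 𝒩⊞_v → 𝒩_v → ℰ• →
ℰ⊢ → An⊢[𝒩⊢⊞] → 𝒩⊢⊞_v` … to the composite functor determined by the path `γ⁰_{v,ν}` [of length 2] `𝒳 → 𝒩⊞_v → 𝒩⊢⊞_v`», `v
∈ V^arc`; at the cross vertex `ν = mult` (`k^×`, Def 5.4 (v)), on `TB⊞`-components — the companion of
`ArchimedeanHolGroupPairsEta` (`ν = pre`):

* the legs: `λ⊞_mult ⋙ (TH⊞ → TB⊞)` (abc-iut-L4-t8's `HolTFPair.lamTimesPlus ⋙ HolTHPlusPair.toTBPlus`: `B = k^×` written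
  additively, `B′ = e⁻¹(exp iℝ)`, `B″ = e⁻¹(exp ℝ)` through THE CAF chart `e_𝕏`, lifted one universe) and `(𝕏 ↶ k) ↦ G_𝕏 ↦
  k×(G_𝕏)` (abc-iut-w6-d025's `TMMono.kTimes`: `k×(G) = C× × C∼ = ℝ/2πℤ × ℝ`, `G_f` acting by its sign);
* both objects of `TB⊞` are quotients of the parametrisation `A_B : ℝ × ℝ ↠ B` (Def 5.6 (i) «`B′ × B″ ⥲ B`») by the SAME
  kernel `2πℤ × 0` (`exp(is + t) = 1 ⟺ t = 0, s ∈ 2πℤ`; `(s mod 2π, t) = 0 ⟺ the same`), and the diagonal `(σ_𝕏, c_𝕏 σ_𝕏)`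
  of signs preserves it: ★ `HolTFPair.etaTimesIso x` is the induced `TB⊞`-ISOMORPHISM (abc-iut-w5-d038's
  `TBPlus.isoOfKernel`), `e⁻¹(e^{is+t}) ↦ (σ_𝕏 s mod 2π, c_𝕏 σ_𝕏 t)`, rescalings `a₁ = σ_𝕏`, `a₂ = c_𝕏 σ_𝕏`;
* ★★ `HolTFPair.etaTimes 𝔄 c hc hcob : lamTimesPlus 𝔄 ⋙ toTBPlus 𝔄 ⋙ TBPlus.uliftFunctor ≅ toEA 𝔄 ⋙ 𝔄.toTMMono ⋙
  TMMono.kTimes` — NATURAL in `(𝕏 ↶ k)` under an orientation cochain (naturality checked on the parametrisation: `σ(G_f) =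
  ε_f σ_𝕏 σ_𝕐`, F3a p486655, and `ε_f = c_𝕏 c_𝕐`); ★★ `HolRS.nonempty_etaTimes_geometric` — unconditional at the geometric
  Aut-holomorphic field functor (p487676).

MODEL-LEVEL; nothing here bears on the disputed [IUTchIII] Cor. 3.12; typed ≠ proved.
-/

set_option autoImplicit false

universe v u

open CategoryTheory Complex

namespace Literature.AnabelianGeometry.AbsoluteAnabelian

/-! ## §1. The kernel of the parametrisation of `k×(G) = ℝ/2πℤ × ℝ` -/

namespace TMMono

/-- `A_{k×(G)}(s, t) = (s mod 2π, t)`. [cite: MochizukiAbsTopIII2015, Prop 5.8 (iv) p.140] -/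
theorem kTimesObj_paramHom_apply (p : ℝ × ℝ) :
    kTimesObj.{v}.paramHom p = ULift.up ((p.1 : AddCircle (2 * Real.pi)), p.2) := by
  rw [TBPlus.paramHom_apply]
  refine ULift.ext _ _ ?_
  change ((p.1 : AddCircle (2 * Real.pi)), (0 : ℝ)) + (0, p.2) = ((p.1 : AddCircle (2 * Real.pi)), p.2)
  rw [Prod.mk_add_mk, add_zero, zero_add]

/-- **`Ker A_{k×(G)} = 2πℤ × 0`.** [cite: MochizukiAbsTopIII2015, Prop 5.8 (iv) p.140] -/
theorem kTimesObj_paramHom_eq_zero_iff (p : ℝ × ℝ) :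
    kTimesObj.{v}.paramHom p = 0 ↔ (∃ n : ℤ, n • (2 * Real.pi) = p.1) ∧ p.2 = 0 := by
  rw [kTimesObj_paramHom_apply]
  change _ = ULift.up (0 : AddCircle (2 * Real.pi) × ℝ) ↔ _
  rw [ULift.up_inj, Prod.mk_eq_zero, AddCircle.coe_eq_zero_iff]

/-- The `ℤ`-action on `k×(G)` through the parametrisation: `n • A(s, t) = A(n s, n t)`. [cite: MochizukiAbsTopIII2015, Prop 5.8 (v) p.140] -/
theorem zsmul_kTimesObj_paramHom (n : ℤ) (p : ℝ × ℝ) :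
    n • kTimesObj.{v}.paramHom p = kTimesObj.{v}.paramHom ((n : ℝ) * p.1, (n : ℝ) * p.2) := by
  rw [← zsmul_eq_mul, ← zsmul_eq_mul, ← Prod.smul_mk, map_zsmul]

/-- `k×(φ)` rescales `B′` by `σ_φ`. [cite: MochizukiAbsTopIII2015, Prop 5.8 (v) p.140] -/
theorem kTimesMap_a₁ {M₁ M₂ : TMMono.{v}} (ψ : M₁ ⟶ M₂) :
    (kTimesMap.{v} ψ).a₁ = sign ψ := rfl

/-- `k×(φ)` rescales `B″` by `σ_φ`. [cite: MochizukiAbsTopIII2015, Prop 5.8 (v) p.140] -/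
theorem kTimesMap_a₂ {M₁ M₂ : TMMono.{v}} (ψ : M₁ ⟶ M₂) :
    (kTimesMap.{v} ψ).a₂ = sign ψ := rfl

end TMMono

/-! ## §2. The kernel of the parametrisation of `(k^×)^{TB⊞}` -/

namespace HolTFPair

variable {𝔄 : AutHolFieldFunctor.{u}}

/-- The Kummer homomorphism of `λ⊞_mult(𝕏 ↶ k)` is `κ` on the units. [cite: MochizukiAbsTopIII2015, Definition 4.1 (iv) p.104] -/
theorem κ_lamTimesPlusObj (x : HolTFPair 𝔄) (b : Additive x.kˣ) :
    (lamTimesPlusObj x).κ b = x.κ ((Additive.toMul b : x.kˣ) : x.k) := rfl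

/-- It is injective (`κ` is a field isomorphism, units are determined by their values).
[cite: MochizukiAbsTopIII2015, Definition 4.1 (iv) p.104] -/
theorem κ_lamTimesPlusObj_injective (x : HolTFPair 𝔄) : Function.Injective (lamTimesPlusObj x).κ := by
  intro a b h
  rw [κ_lamTimesPlusObj, κ_lamTimesPlusObj] at h
  exact Additive.toMul.injective (Units.ext (x.κ.injective h))

/-- `b = 0` in `k^×` iff `κ(b) = 1`. [cite: MochizukiAbsTopIII2015, Definition 4.1 (iv) p.104] -/
theorem lamTimesPlusObj_eq_zero_iff (x : HolTFPair 𝔄) (b : Additive x.kˣ) : b = 0 ↔ (lamTimesPlusObj x).κ b = 1 := by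
  rw [← (lamTimesPlusObj x).κ_zero]
  exact ⟨fun h => h ▸ rfl, fun h => κ_lamTimesPlusObj_injective x h⟩

/-- `κ` through the CAF chart: `κ(e⁻¹(w)) = cafChart_𝕏⁻¹(w)`. [cite: MochizukiAbsTopIII2015, Definition 5.6 (iv) p.136] -/
theorem κ_cafChart_symm (x : HolTFPair 𝔄) (w : ℂ) : x.κ (x.cafChart.symm w) = (𝔄.cafChart x.X).symm w := by
  change x.κ (x.κ.symm ((𝔄.cafChart x.X).symm w)) = _
  rw [RingEquiv.apply_symm_apply]

/-- **The Kummer homomorphism on the parametrisation of `(k^×)^{TB⊞}`**: `κ(A(s, t)) = cafChart_𝕏⁻¹(e^{is + t})`.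
[cite: MochizukiAbsTopIII2015, Definition 5.6 (iv) p.136] -/
theorem κ_paramHom_lamTimesPlusObj (x : HolTFPair 𝔄) (p : ℝ × ℝ) :
    (lamTimesPlusObj x).κ ((lamTimesPlusObj x).toTBPlusObj.paramHom p) =
      (𝔄.cafChart x.X).symm (exp (I * p.1 + p.2)) := by
  rw [TBPlus.paramHom_apply]
  refine ((lamTimesPlusObj x).κ_add _ _).trans ?_
  rw [HolTHPlusPair.κ_c₁, HolTHPlusPair.κ_c₂, chart_lamTimesPlusObj]
  change x.κ (x.cafChart.symm _) * x.κ (x.cafChart.symm _) = _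
  rw [κ_cafChart_symm, κ_cafChart_symm, ← map_mul, ← Complex.exp_add]

/-- `e^{is + t} = 1 ⟺ t = 0 ∧ s ∈ 2πℤ`. [cite: MochizukiAbsTopIII2015, Definition 5.6 (iv) p.136] -/
theorem exp_I_mul_add_eq_one_iff (s t : ℝ) :
    exp (I * s + t) = 1 ↔ (∃ n : ℤ, n • (2 * Real.pi) = s) ∧ t = 0 := by
  rw [Complex.exp_eq_one_iff]
  constructor
  · rintro ⟨n, hn⟩
    have hre := congrArg Complex.re hn
    have him := congrArg Complex.im hn
    simp only [add_re, mul_re, I_re, ofReal_re, zero_mul, I_im, ofReal_im, mul_zero, sub_zero, zero_add,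
      intCast_re, mul_im, intCast_im, add_im, re_ofNat, im_ofNat] at hre him
    refine ⟨⟨n, ?_⟩, ?_⟩
    · rw [zsmul_eq_mul]; linarith
    · linarith
  · rintro ⟨⟨n, hn⟩, ht⟩
    refine ⟨n, ?_⟩
    rw [ht, ofReal_zero, add_zero, ← hn, zsmul_eq_mul]
    push_cast
    ring

/-- **`Ker A_{(k^×)^{TB⊞}} = 2πℤ × 0`.** [cite: MochizukiAbsTopIII2015, Definition 5.6 (iv) p.136] -/
theorem paramHom_lamTimesPlusObj_eq_zero_iff (x : HolTFPair 𝔄) (p : ℝ × ℝ) :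
    (lamTimesPlusObj x).toTBPlusObj.paramHom p = 0 ↔ (∃ n : ℤ, n • (2 * Real.pi) = p.1) ∧ p.2 = 0 := by
  refine (lamTimesPlusObj_eq_zero_iff x _).trans ?_
  rw [κ_paramHom_lamTimesPlusObj, ← exp_I_mul_add_eq_one_iff, ← (𝔄.cafChart x.X).symm.injective.eq_iff, map_one]
  exact Iff.rfl

/-- The lifted parametrisation is the parametrisation, lifted. [cite: MochizukiAbsTopIII2015, Def 5.6 (i) p. 134] -/
theorem uliftObj_paramHom_apply (M : TBPlus.{u}) (p : ℝ × ℝ) :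
    (TBPlus.uliftObj.{v} M).paramHom p = ULift.up (M.paramHom p) := rfl

/-- **`Ker A` of the lifted `(k^×)^{TB⊞}` is `2πℤ × 0`.** [cite: MochizukiAbsTopIII2015, Definition 5.6 (iv) p.136] -/
theorem paramHom_ulift_lamTimesPlusObj_eq_zero_iff (x : HolTFPair 𝔄) (p : ℝ × ℝ) :
    (TBPlus.uliftObj.{u + 1} (lamTimesPlusObj x).toTBPlusObj).paramHom p = 0 ↔
      (∃ n : ℤ, n • (2 * Real.pi) = p.1) ∧ p.2 = 0 := by
  rw [uliftObj_paramHom_apply, ← paramHom_lamTimesPlusObj_eq_zero_iff]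
  exact ULift.up_inj

/-! ## §3. The component `η⊢_𝕏 : (k^×)^{TB⊞} ⥲ k×(G_𝕏)` -/

/-- A sign does not change membership in `2πℤ`. [folklore] -/
private theorem exists_zsmul_eq_mul_iff {σ : ℝ} (hσ : σ = 1 ∨ σ = -1) (s : ℝ) :
    (∃ n : ℤ, n • (2 * Real.pi) = σ * s) ↔ ∃ n : ℤ, n • (2 * Real.pi) = s := by
  rcases hσ with h | h
  · rw [h, one_mul]
  · rw [h, neg_one_mul]
    constructor
    · rintro ⟨n, hn⟩
      exact ⟨-n, by rw [neg_zsmul, hn, neg_neg]⟩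
    · rintro ⟨n, hn⟩
      exact ⟨-n, by rw [neg_zsmul, hn]⟩

/-- A sign is nonzero. [folklore] -/
private theorem ne_zero_of_eq_one_or {a : ℝ} (h : a = 1 ∨ a = -1) : a ≠ 0 := by
  rcases h with h | h <;> rw [h] <;> norm_num

/-- A sign has absolute value one. [folklore] -/
private theorem abs_eq_one_of_eq_one_or {a : ℝ} (h : a = 1 ∨ a = -1) : |a| = 1 := by
  rcases h with h | h <;> rw [h] <;> norm_num

section Component

variable (c : 𝔄.EA → ℝ) (x : HolTFPair 𝔄) (hc : ∀ X : 𝔄.EA, c X = 1 ∨ c X = -1)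
include hc

/-- The product of a cochain value and a chart sign is a sign. [cite: MochizukiAbsTopIII2015, Cor 5.10 (iv)(c) p.148] -/
theorem c_mul_chartSign_eq_one_or : c x.X * 𝔄.chartSign x.X = 1 ∨ c x.X * 𝔄.chartSign x.X = -1 := by
  rcases hc x.X with h | h <;> rcases 𝔄.chartSign_eq_one_or x.X with h' | h' <;> rw [h, h'] <;> norm_num

/-- **The kernels agree along the diagonal `(σ_𝕏, c_𝕏 σ_𝕏)`.** [cite: MochizukiAbsTopIII2015, Cor 5.10 (iv)(c) p.148] -/
theorem kernel_etaTimes (p : ℝ × ℝ) :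
    (TBPlus.uliftObj.{u + 1} (lamTimesPlusObj x).toTBPlusObj).paramHom p = 0 ↔
      TMMono.kTimesObj.{u + 1}.paramHom (TBPlus.diag (𝔄.chartSign x.X) (c x.X * 𝔄.chartSign x.X) p) = 0 := by
  rw [paramHom_ulift_lamTimesPlusObj_eq_zero_iff, TMMono.kTimesObj_paramHom_eq_zero_iff, TBPlus.diag_apply,
    exists_zsmul_eq_mul_iff (𝔄.chartSign_eq_one_or x.X),
    mul_eq_zero_iff_left (ne_zero_of_eq_one_or (c_mul_chartSign_eq_one_or c x hc))]

/-- ★ **`η⊢_𝕏` at the vertex `mult` is an ISOMORPHISM of `TB⊞`** `(k^×)^{TB⊞}(𝕏 ↶ k) ⥲ k×(G_𝕏)`, induced on the common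
quotient of `ℝ × ℝ` by the diagonal `(σ_𝕏, c_𝕏 σ_𝕏)`: `e⁻¹(e^{is + t}) ↦ (σ_𝕏 s mod 2π, c_𝕏 σ_𝕏 t)`.
[cite: MochizukiAbsTopIII2015, Cor 5.10 (iv)(c) p.148] -/
noncomputable def etaTimesIso :
    TBPlus.uliftObj.{u + 1} (lamTimesPlusObj x).toTBPlusObj ≅ TMMono.kTimesObj.{u + 1} :=
  TBPlus.isoOfKernel _ _ (𝔄.chartSign x.X) (c x.X * 𝔄.chartSign x.X) (kernel_etaTimes c x hc)
    (ne_zero_of_eq_one_or (𝔄.chartSign_eq_one_or x.X)) (ne_zero_of_eq_one_or (c_mul_chartSign_eq_one_or c x hc))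
    (by
      change |c x.X * 𝔄.chartSign x.X| * (1 : ℝ) = 1 * |𝔄.chartSign x.X|
      rw [abs_eq_one_of_eq_one_or (c_mul_chartSign_eq_one_or c x hc),
        abs_eq_one_of_eq_one_or (𝔄.chartSign_eq_one_or x.X)])

/-- `η⊢_𝕏` on the parametrisation: `A(s, t) ↦ A(σ_𝕏 s, c_𝕏 σ_𝕏 t)`. [cite: MochizukiAbsTopIII2015, Cor 5.10 (iv)(c) p.148] -/
theorem etaTimesIso_hom_toHom_paramHom (p : ℝ × ℝ) :
    (etaTimesIso c x hc).hom.toHom ((TBPlus.uliftObj.{u + 1} (lamTimesPlusObj x).toTBPlusObj).paramHom p) =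
      TMMono.kTimesObj.{u + 1}.paramHom (TBPlus.diag (𝔄.chartSign x.X) (c x.X * 𝔄.chartSign x.X) p) :=
  TBPlus.isoOfKernel_hom_toHom_paramHom _ _ _ _ _ _ _ _ p

/-- `a₁(η⊢_𝕏) = σ_𝕏`. [cite: MochizukiAbsTopIII2015, Cor 5.10 (iv)(c) p.148] -/
theorem etaTimesIso_hom_a₁ : (etaTimesIso c x hc).hom.a₁ = 𝔄.chartSign x.X := rfl

/-- `a₂(η⊢_𝕏) = c_𝕏 σ_𝕏`. [cite: MochizukiAbsTopIII2015, Cor 5.10 (iv)(c) p.148] -/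
theorem etaTimesIso_hom_a₂ : (etaTimesIso c x hc).hom.a₂ = c x.X * 𝔄.chartSign x.X := rfl

end Component

/-! ## §4. Naturality in `(𝕏 ↶ k)` -/

/-- **The `B′`-rescaling of a morphism of `𝒞^hol_{TH⊞}` is the transition sign of its base** (abc-iut-L4-t8's `Hom.sign`,
read off `τ(i) = ±i`, versus `ε_f`). [cite: MochizukiAbsTopIII2015, Rmk 5.8.1 (i) p.142] -/
theorem _root_.Literature.AnabelianGeometry.AbsoluteAnabelian.HolTHPlusPair.Hom.sign_eq_transitionSign
    {P Q : HolTHPlusPair 𝔄} (φ : P ⟶ Q) : HolTHPlusPair.Hom.sign φ = AutHolFieldFunctor.transitionSign φ.base := by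
  change (HolTHPlusPair.Hom.τ φ I).im = _
  rw [HolTHPlusPair.Hom.τ_apply_eq_transition, AutHolFieldFunctor.im_transition, I_im, mul_one]

/-- The `TB⊞`-leg rescales `B′` by abc-iut-L4-t8's `Hom.sign`. [cite: MochizukiAbsTopIII2015, Definition 5.6 (iv) p.136] -/
theorem _root_.Literature.AnabelianGeometry.AbsoluteAnabelian.HolTHPlusPair.toTBPlusMap_a₁
    {P Q : HolTHPlusPair 𝔄} (φ : P ⟶ Q) : (HolTHPlusPair.toTBPlusMap φ).a₁ = HolTHPlusPair.Hom.sign φ := rfl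

/-- The `TB⊞`-leg does not rescale `B″`. [cite: MochizukiAbsTopIII2015, Definition 5.6 (iv) p.136] -/
theorem _root_.Literature.AnabelianGeometry.AbsoluteAnabelian.HolTHPlusPair.toTBPlusMap_a₂
    {P Q : HolTHPlusPair 𝔄} (φ : P ⟶ Q) : (HolTHPlusPair.toTBPlusMap φ).a₂ = 1 := rfl

/-- **The `TB⊞`-leg of `λ⊞_mult(φ)` rescales `B′` by the transition sign `ε_{φ_𝕏}`.** [cite: MochizukiAbsTopIII2015, Rmk 5.8.1 (i) p.142] -/
theorem a₁_toTBPlusMap_lamTimesPlus_map {x y : HolTFPair 𝔄} (φ : x ⟶ y) :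
    (HolTHPlusPair.toTBPlusMap (P := lamTimesPlusObj x) (Q := lamTimesPlusObj y) ((lamTimesPlus 𝔄).map φ)).a₁ =
      AutHolFieldFunctor.transitionSign φ.base :=
  HolTHPlusPair.Hom.sign_eq_transitionSign _

section Natural

variable (𝔄)
variable (c : 𝔄.EA → ℝ) (hc : ∀ X : 𝔄.EA, c X = 1 ∨ c X = -1)
  (hcob : ∀ {X Y : 𝔄.EA} (f : X ⟶ Y), AutHolFieldFunctor.transitionSign f = c X * c Y)
include hc hcob

/-- **NATURALITY SQUARE of `η⊢` at `mult`**, checked on the parametrisation `A(s, t)`: both ways round send `A(s, t)` to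
`A(± s, ± t)` with the same signs, by `σ(G_f) = ε_f σ_𝕏 σ_𝕐` (F3a) and `ε_f = c_𝕏 c_𝕐`.
[cite: MochizukiAbsTopIII2015, Cor 5.10 (iv)(c) p.148] -/
theorem etaTimes_naturality_paramHom {x y : HolTFPair 𝔄} (φ : x ⟶ y) (p : ℝ × ℝ) :
    (etaTimesIso c y hc).hom.toHom ((TBPlus.uliftHom.{u + 1}
        (HolTHPlusPair.toTBPlusMap (P := lamTimesPlusObj x) (Q := lamTimesPlusObj y) ((lamTimesPlus 𝔄).map φ))).toHom
          ((TBPlus.uliftObj.{u + 1} (lamTimesPlusObj x).toTBPlusObj).paramHom p)) =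
      (TMMono.kTimesMap.{u + 1} (𝔄.toTMMono.map φ.base)).toHom ((etaTimesIso c x hc).hom.toHom
        ((TBPlus.uliftObj.{u + 1} (lamTimesPlusObj x).toTBPlusObj).paramHom p)) := by
  rw [etaTimesIso_hom_toHom_paramHom c x hc p, TBPlus.toHom_paramHom (TMMono.kTimesMap.{u + 1} _),
    TBPlus.toHom_paramHom, etaTimesIso_hom_toHom_paramHom]
  simp only [TBPlus.diag_apply, TBPlus.uliftHom_a₁, TBPlus.uliftHom_a₂, a₁_toTBPlusMap_lamTimesPlus_map,
    HolTHPlusPair.toTBPlusMap_a₂, TMMono.kTimesMap_a₁, TMMono.kTimesMap_a₂, one_mul, 𝔄.sign_toTMMono_map_eq,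
    hcob φ.base]
  have h₁ : c x.X * c x.X = 1 := by rcases hc x.X with h | h <;> rw [h] <;> norm_num
  have h₂ := 𝔄.chartSign_mul_self x.X
  congr 1
  refine Prod.ext ?_ ?_
  · calc 𝔄.chartSign y.X * (c x.X * c y.X * p.1)
        = c x.X * c y.X * (𝔄.chartSign x.X * 𝔄.chartSign x.X) * 𝔄.chartSign y.X * p.1 := by rw [h₂]; ring
      _ = c x.X * c y.X * 𝔄.chartSign x.X * 𝔄.chartSign y.X * (𝔄.chartSign x.X * p.1) := by ring
  · calc c y.X * 𝔄.chartSign y.X * p.2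
        = (c x.X * c x.X) * (𝔄.chartSign x.X * 𝔄.chartSign x.X) * c y.X * 𝔄.chartSign y.X * p.2 := by
          rw [h₁, h₂]; ring
      _ = c x.X * c y.X * 𝔄.chartSign x.X * 𝔄.chartSign y.X * (c x.X * 𝔄.chartSign x.X * p.2) := by ring

/-- **NATURALITY of `η⊢` at `mult`** as an equation of `TB⊞`-morphisms. [cite: MochizukiAbsTopIII2015, Cor 5.10 (iv)(c) p.148] -/
theorem etaTimes_naturality {x y : HolTFPair 𝔄} (φ : x ⟶ y) :
    TBPlus.uliftFunctor.{u + 1}.map ((HolTHPlusPair.toTBPlus 𝔄).map ((lamTimesPlus 𝔄).map φ)) ≫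
        (etaTimesIso c y hc).hom =
      (etaTimesIso c x hc).hom ≫ TMMono.kTimes.map (𝔄.toTMMono.map φ.base) :=
  TBPlus.hom_ext_paramHom fun p => etaTimes_naturality_paramHom 𝔄 c hc hcob φ p

/-- ★★ **The archimedean `η⊢_{v,ν}` at `ν = mult`** (Cor 5.10 (iv)(c)): the natural isomorphism between
`𝒳 → 𝒩⊞_v → 𝒩⊢⊞_v` (`λ⊞_mult`, then `𝒞^hol_{TH⊞} → TB⊞`) and `𝒳 → 𝒢 → ℰ⊢ → 𝒩⊢⊞_v` (`(𝕏 ↶ k) ↦ G_𝕏 ↦ k×(G_𝕏)`),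
on `TB⊞`-components, under an orientation cochain. [cite: MochizukiAbsTopIII2015, Cor 5.10 (iv)(c) p.148] -/
noncomputable def etaTimes : lamTimesPlus 𝔄 ⋙ HolTHPlusPair.toTBPlus 𝔄 ⋙ TBPlus.uliftFunctor.{u + 1} ≅
    toEA 𝔄 ⋙ 𝔄.toTMMono ⋙ TMMono.kTimes :=
  NatIso.ofComponents (fun x => etaTimesIso c x hc) fun φ => etaTimes_naturality 𝔄 c hc hcob φ

/-- The component of `η⊢` at `(𝕏 ↶ k)`. [cite: MochizukiAbsTopIII2015, Cor 5.10 (iv)(c) p.148] -/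
theorem etaTimes_hom_app (x : HolTFPair 𝔄) : (etaTimes 𝔄 c hc hcob).hom.app x = (etaTimesIso c x hc).hom := rfl

end Natural

/-- **Existence form** at `ν = mult`. [cite: MochizukiAbsTopIII2015, Cor 5.10 (iv)(c) p.148] -/
theorem nonempty_etaTimes_of_cochain (𝔄 : AutHolFieldFunctor.{u})
    (h : ∃ c : 𝔄.EA → ℝ, (∀ X, c X = 1 ∨ c X = -1) ∧
      ∀ {X Y : 𝔄.EA} (f : X ⟶ Y), AutHolFieldFunctor.transitionSign f = c X * c Y) :
    Nonempty (lamTimesPlus 𝔄 ⋙ HolTHPlusPair.toTBPlus 𝔄 ⋙ TBPlus.uliftFunctor.{u + 1} ≅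
      toEA 𝔄 ⋙ 𝔄.toTMMono ⋙ TMMono.kTimes) := by
  obtain ⟨c, hc, hcob⟩ := h
  exact ⟨etaTimes 𝔄 c hc hcob⟩

end HolTFPair

/-! ## §5. The geometric case -/

namespace HolRS

/-- ★★ **At the geometric Aut-holomorphic field functor the archimedean `η⊢_{v,mult}` EXISTS unconditionally.**
[cite: MochizukiAbsTopIII2015, Cor 5.10 (iv)(c) p.148] -/
theorem nonempty_etaTimes_geometric (Q : ObjectProperty HolRS) :
    Nonempty (HolTFPair.lamTimesPlus (geometricAutHolFieldFunctor Q) ⋙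
        HolTHPlusPair.toTBPlus (geometricAutHolFieldFunctor Q) ⋙ TBPlus.uliftFunctor.{1} ≅
      HolTFPair.toEA (geometricAutHolFieldFunctor Q) ⋙ (geometricAutHolFieldFunctor Q).toTMMono ⋙ TMMono.kTimes) :=
  HolTFPair.nonempty_etaTimes_of_cochain _ (exists_orientationCochain_geometric Q)

end HolRS

end Literature.AnabelianGeometry.AbsoluteAnabelian
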